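import Summits.ValiantsHypothesis.ValiantsHypothesis.Theorems.BarrierLeverAnchoredDoorHitsLowerPairsEvalCompressed
import Summits.ValiantsHypothesis.ValiantsHypothesis.Theorems.BarrierLeverAnchoredDoorHitsLowerPairsStarDoor
import Mathlib.Topology.Instances.Matrix
import Mathlib.Analysis.Complex.Basic

/-!
# Route BarrierLever — support item `AnchoredDoorHitsLowerPairs` (stmt-ValiantsHypothesis-22510), line `anchored_peeling`:
# THE EVALUATION FACES OF THE STAR-FOREST MATRIX (val-np-p1 g31)

The door slot of record of the item is the conjecture `Stmt.conjStarLower` (…StarDoor, p725521; arrow …StarArrow, p727740): every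
lower pair has a nonsingular block of the STAR-FOREST MATRIX `(starEntry g d A S)`. This file puts the first infinite certified classes
under that conjecture (and under its theory target `Stmt.conjStarTN`) by identifying the two EVALUATION FACES of the star-forest matrix:

* `starEntry_zero_right`: at `d = 0` the entry is `∏_{b ∈ A} (1 + Σ_{e ∈ S} g b e)` — the evaluation door `E(g)` with the root weights
  shifted by one (only the row vertices hang, as leaves, from column centres; every column vertex is an isolated centre);
* `starEntry_zero_left`: at `g = 0` it is `∏_{e ∈ S} (1 + Σ_{b ∈ A} d b e)` — the transposed door `Eᵀ(d)`;
* `starEntry_swap`: the matrix is symmetric under exchanging the two vertex sides together with `g ↔ dᵀ`.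

MAIN TRANSFER (`starDet_ne_zero_of_evalDet`, no lower-set or injectivity hypothesis): if SOME evaluation matrix
`(∏_{b ∈ u i} Σ_{γ ∈ w j} θ_{bγ})_{ij}` is nonsingular then some star-forest block `(starEntry g d (u i) (w j))_{ij}` is nonsingular.
PROOF: `s ↦ det (∏_{b ∈ u i} (s + Σ_{γ ∈ w j} θ_{bγ}))` is continuous on `ℂ` and nonzero at `s = 0`, hence nonzero at some `s ≠ 0`;
dividing row `i` by `s^{|u i|}` gives the star block at `g = θ / s`, `d = 0`. The swapped transfer `starDet_ne_zero_of_evalDet_swap` is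
the same through `starEntry_swap` and `Matrix.det_transpose`.

CONSEQUENCES (with the Frobenius–Vandermonde theorem `EvalGP.exists_evalDet_ne_zero_of_compressed`, p724260): `starDet_ne_zero_of_compressed`
and `starDet_ne_zero_of_compressed_swap` — EVERY pair of injective families one side of which is COMPRESSED (an initial colex segment for
some injective vertex labelling; in particular every full cube, every cube minus its top face, every punctured cube `2^[n−1] ∗ {∅,p,q}`)
has a nonsingular star-forest block, for ANY injective family on the other side (no lower-set hypothesis): these are instances of
`Stmt.conjStarTN` by name, not only of `Stmt.conjStarLower`.

WHAT THIS IS NOT. It does not prove `Stmt.conjStarLower`: the evaluation faces are singular exactly when the interpolation count fails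
(three points against an edge) and on the cone-versus-even-cycle accidents (`K_{1,4}` against `C₄ ⊔ pt`), see the memo
HOME/val-np-p1/g31/MEMO-trop-valnp1-g31.md; those pairs need the interior of the star-forest matrix. Nothing here bears on crux 14610
or on `VP ≠ VNP`.
-/

set_option linter.dupNamespace false

namespace Summit.ValiantsHypothesis.ValiantsHypothesis.Theorems.BarrierLever.AnchoredPeeling

open Finset

noncomputable section

namespace StarDoor

variable {K : Type*} [CommRing K] {h : ℕ}

/-- **The `d = 0` face is the evaluation door.** With no column leaves, every column vertex is a centre and every row vertex is either an
isolated centre or a leaf: `starEntry g 0 A S = ∏_{b ∈ A} (1 + Σ_{e ∈ S} g b e)`. -/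
theorem starEntry_zero_right (g : Fin h → Fin h → K) (A S : Finset (Fin h)) :
    starEntry g 0 A S = ∏ b ∈ A, (1 + ∑ e ∈ S, g b e) := by
  classical
  unfold starEntry
  have hinner : ∀ A' ∈ A.powerset,
      (∑ S' ∈ S.powerset, (∏ b ∈ A \ A', ∑ e ∈ S', g b e) * (∏ e ∈ S \ S', ∑ b ∈ A', (0 : Fin h → Fin h → K) b e))
        = ∏ b ∈ A \ A', ∑ e ∈ S, g b e := by
    intro A' _
    rw [Finset.sum_eq_single_of_mem S (Finset.mem_powerset.mpr (subset_refl S))]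
    · simp
    · intro S' hS' hne
      have hsub : S' ⊆ S := Finset.mem_powerset.mp hS'
      obtain ⟨e, he⟩ : (S \ S').Nonempty := by
        rw [Finset.sdiff_nonempty]
        exact fun hSS' => hne (subset_antisymm hsub hSS')
      have hzero : (∏ e ∈ S \ S', ∑ b ∈ A', (0 : Fin h → Fin h → K) b e) = 0 :=
        Finset.prod_eq_zero he (by simp)
      rw [hzero, mul_zero]
  rw [Finset.sum_congr rfl hinner]
  -- `∏_{b ∈ A} (1 + c_b) = Σ_{A' ⊆ A} (∏_{b ∈ A'} 1) · ∏_{b ∈ A ∖ A'} c_b`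
  rw [Finset.prod_add]
  exact Finset.sum_congr rfl fun t _ => by simp

/-- **The two vertex sides are exchangeable:** `starEntry g d A S = starEntry dᵀ gᵀ S A` (swap rows with columns and the two kinds of
leaf edges). -/
theorem starEntry_swap (g d : Fin h → Fin h → K) (A S : Finset (Fin h)) :
    starEntry g d A S = starEntry (fun e b => d b e) (fun e b => g b e) S A := by
  unfold starEntry
  rw [Finset.sum_comm]
  refine Finset.sum_congr rfl fun S' _ => Finset.sum_congr rfl fun A' _ => ?_
  rw [mul_comm]

/-- **The `g = 0` face is the transposed evaluation door:** `starEntry 0 d A S = ∏_{e ∈ S} (1 + Σ_{b ∈ A} d b e)`. -/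
theorem starEntry_zero_left (d : Fin h → Fin h → K) (A S : Finset (Fin h)) :
    starEntry 0 d A S = ∏ e ∈ S, (1 + ∑ b ∈ A, d b e) := by
  rw [starEntry_swap]
  exact starEntry_zero_right (K := K) (fun e b => d b e) S A

/-- Scaling identity behind the transfer: for `s ≠ 0`,
`∏_{b ∈ A} (1 + Σ_{e ∈ S} θ_{be} / s) = (s ^ |A|)⁻¹ · ∏_{b ∈ A} (s + Σ_{e ∈ S} θ_{be})`. -/
theorem prod_one_add_div (θ : Fin h → Fin h → ℂ) (A S : Finset (Fin h)) {s : ℂ} (hs : s ≠ 0) :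
    ∏ b ∈ A, (1 + ∑ e ∈ S, θ b e / s) = (s ^ A.card)⁻¹ * ∏ b ∈ A, (s + ∑ e ∈ S, θ b e) := by
  have hfac : ∀ b ∈ A, (1 + ∑ e ∈ S, θ b e / s) = s⁻¹ * (s + ∑ e ∈ S, θ b e) := by
    intro b _
    rw [← Finset.sum_div]
    field_simp
  rw [Finset.prod_congr rfl hfac, Finset.prod_mul_distrib, Finset.prod_const, inv_pow]

/-- **TRANSFER: a nonsingular evaluation matrix gives a nonsingular star-forest block** (same row and column families; no lower-set or
injectivity hypothesis). If `det (∏_{b ∈ u i} Σ_{γ ∈ w j} θ_{bγ})_{ij} ≠ 0` for some complex `θ`, then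
`det (starEntry g d (u i) (w j))_{ij} ≠ 0` for `g = θ / s`, `d = 0` and a suitable `s ≠ 0`. -/
theorem starDet_ne_zero_of_evalDet {r : ℕ} (u w : Fin r → Finset (Fin h))
    (hE : ∃ θ : Fin h → Fin h → ℂ, (Matrix.of fun i j : Fin r => ∏ b ∈ u i, ∑ γ ∈ w j, θ b γ).det ≠ 0) :
    ∃ g d : Fin h → Fin h → ℂ, (Matrix.of fun i j : Fin r => starEntry g d (u i) (w j)).det ≠ 0 := by
  classical
  obtain ⟨θ, hθ⟩ := hE
  -- the continuous function `s ↦ det (∏_{b ∈ u i} (s + p_{b j}))`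
  let F : ℂ → Matrix (Fin r) (Fin r) ℂ := fun s => Matrix.of fun i j : Fin r => ∏ b ∈ u i, (s + ∑ γ ∈ w j, θ b γ)
  have hcontF : Continuous F := by
    refine continuous_matrix fun i j => ?_
    show Continuous fun s : ℂ => ∏ b ∈ u i, (s + ∑ γ ∈ w j, θ b γ)
    exact continuous_finsetProd _ fun b _ => continuous_id.add continuous_const
  have hcont : Continuous fun s => (F s).det := hcontF.matrix_det
  have hF0 : (F 0).det ≠ 0 := by
    have hmat : F 0 = Matrix.of fun i j : Fin r => ∏ b ∈ u i, ∑ γ ∈ w j, θ b γ := by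
      ext i j
      simp [F]
    rw [hmat]
    exact hθ
  have hev : ∀ᶠ s in nhds (0 : ℂ), (F s).det ≠ 0 := hcont.continuousAt.eventually_ne hF0
  have hev' : ∀ᶠ s in nhdsWithin (0 : ℂ) {0}ᶜ, (F s).det ≠ 0 ∧ s ∈ ({0}ᶜ : Set ℂ) :=
    (hev.filter_mono nhdsWithin_le_nhds).and self_mem_nhdsWithin
  obtain ⟨s, hsdet, hs0⟩ := hev'.exists
  have hs : s ≠ 0 := hs0
  refine ⟨fun b γ => θ b γ / s, 0, ?_⟩
  have hmat : (Matrix.of fun i j : Fin r => starEntry (fun b γ => θ b γ / s) 0 (u i) (w j))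
      = Matrix.of fun i j : Fin r => (s ^ (u i).card)⁻¹ * F s i j := by
    ext i j
    simp only [Matrix.of_apply, F]
    rw [starEntry_zero_right, prod_one_add_div θ (u i) (w j) hs]
  rw [hmat, Matrix.det_mul_column]
  refine mul_ne_zero (Finset.prod_ne_zero_iff.mpr fun i _ => ?_) hsdet
  exact inv_ne_zero (pow_ne_zero _ hs)

/-- **TRANSFER, swapped orientation:** a nonsingular TRANSPOSED evaluation matrix `(∏_{e ∈ w i} Σ_{a ∈ u j} θ_{ea})_{ij}` (column
monomials at the subset-sum points of the rows) also gives a nonsingular star-forest block of `(u, w)`. -/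
theorem starDet_ne_zero_of_evalDet_swap {r : ℕ} (u w : Fin r → Finset (Fin h))
    (hE : ∃ θ : Fin h → Fin h → ℂ, (Matrix.of fun i j : Fin r => ∏ e ∈ w i, ∑ a ∈ u j, θ e a).det ≠ 0) :
    ∃ g d : Fin h → Fin h → ℂ, (Matrix.of fun i j : Fin r => starEntry g d (u i) (w j)).det ≠ 0 := by
  obtain ⟨g', d', hdet⟩ := starDet_ne_zero_of_evalDet w u hE
  refine ⟨fun b e => d' e b, fun b e => g' e b, ?_⟩
  have hmat : (Matrix.of fun i j : Fin r => starEntry (fun b e => d' e b) (fun b e => g' e b) (u i) (w j))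
      = (Matrix.of fun i j : Fin r => starEntry g' d' (w i) (u j)).transpose := by
    ext i j
    simp only [Matrix.of_apply, Matrix.transpose_apply]
    rw [starEntry_swap]
  rw [hmat, Matrix.det_transpose]
  exact hdet

/-- **EVERY PAIR WITH COMPRESSED ROWS HAS A NONSINGULAR STAR-FOREST BLOCK** (an instance of `Stmt.conjStarTN` by name: no lower-set
hypothesis on either side). Rows `u` injective and compressed — `Σ_{b ∈ u i} 2^{e b} < r` for an injective labelling `e` — and columns `w`
injective: Frobenius–Vandermonde (`EvalGP.exists_evalDet_ne_zero_of_compressed`) plus the transfer. -/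
theorem starDet_ne_zero_of_compressed {r : ℕ} (u w : Fin r → Finset (Fin h)) (hu : Function.Injective u)
    (hw : Function.Injective w) (e : Fin h → ℕ) (he : Function.Injective e) (hlt : ∀ i, ∑ b ∈ u i, 2 ^ e b < r) :
    ∃ g d : Fin h → Fin h → ℂ, (Matrix.of fun i j : Fin r => starEntry g d (u i) (w j)).det ≠ 0 :=
  starDet_ne_zero_of_evalDet u w (EvalGP.exists_evalDet_ne_zero_of_compressed u w hu hw e he hlt)

/-- **… and with compressed COLUMNS** (swapped orientation). -/
theorem starDet_ne_zero_of_compressed_swap {r : ℕ} (u w : Fin r → Finset (Fin h)) (hu : Function.Injective u)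
    (hw : Function.Injective w) (e : Fin h → ℕ) (he : Function.Injective e) (hlt : ∀ j, ∑ c ∈ w j, 2 ^ e c < r) :
    ∃ g d : Fin h → Fin h → ℂ, (Matrix.of fun i j : Fin r => starEntry g d (u i) (w j)).det ≠ 0 :=
  starDet_ne_zero_of_evalDet_swap u w (EvalGP.exists_evalDet_ne_zero_of_compressed w u hw hu e he hlt)

end StarDoor

end

end Summit.ValiantsHypothesis.ValiantsHypothesis.Theorems.BarrierLever.AnchoredPeeling
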